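import Mathlib

/-!
# SoloBlind: the glue-group isomorphism behind THEOREM Φ(o)

THEOREM Φ (side line O1b, `paper/theoremPhi.md` §2–§3) identifies the finite Hecke module
`C = L/(A ⊕ B)` — `L` the Brandt lattice of the Eichler order of level `w`, `B = ker π` the `w`-new
sublattice, `A = B^⊥` the `w`-old sublattice — with the component group `Φ_w(J^{Mw}) = B^∨/B`
(Grothendieck's description via the monodromy pairing).  Part (o) of the proof is pure lattice
algebra: if the pairing on `L` is perfect and `B` is a direct summand ("saturated"), then
restriction of functionals `L → B^∨` is surjective with kernel `A = B^⊥`, whence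
`L/(A + B) ≅ B^∨ / (image of B) = B^∨/B`.

This file kernel-checks that step over an arbitrary commutative ring:

* `soloBlind_quotKerSup_equiv`: for a surjective linear map `f : L → M` and a submodule `B ≤ L`,
  the map `x ↦ f x` induces `L ⧸ (ker f ⊔ B) ≃ M ⧸ f(B)`;
* `soloBlind_restrict_surjective`: if `b : L → L → R` is left-perfect (every functional is `b x`)
  and `B` admits a linear retraction `r : L → B`, then restriction `x ↦ b x |_B` is onto `B^∨`;
* `soloBlind_glueGroup_equiv`: under those hypotheses, `L ⧸ (B^⊥ ⊔ B) ≃ B^∨ ⧸ range (Gram map of B)`,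
  induced by restriction, where `B^⊥ = {x | ∀ y ∈ B, b x y = 0}` is the kernel of restriction;
* `soloBlind_glueGroup_card`: the two quotients have the same cardinality (the index statement
  `[L : A ⊕ B] = #Φ` used in THEOREM Φ(ii)).
-/

namespace Summit.Langlands.Langlands.Theorems

variable {R : Type*} [CommRing R]
variable {L M : Type*} [AddCommGroup L] [Module R L] [AddCommGroup M] [Module R M]

/-- For a surjective linear map `f` and a submodule `B`, `x ↦ f x` induces an isomorphism
`L ⧸ (ker f ⊔ B) ≃ₗ M ⧸ f(B)`. -/
theorem soloBlind_quotKerSup_equiv (f : L →ₗ[R] M) (hf : Function.Surjective f)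
    (B : Submodule R L) :
    ∃ e : (L ⧸ (LinearMap.ker f ⊔ B)) ≃ₗ[R] (M ⧸ B.map f),
      ∀ x : L, e (Submodule.Quotient.mk x) = Submodule.Quotient.mk (f x) := by
  let g : L →ₗ[R] (M ⧸ B.map f) := (B.map f).mkQ.comp f
  have hg : Function.Surjective g :=
    (Submodule.mkQ_surjective (B.map f)).comp hf
  have hker : LinearMap.ker g = LinearMap.ker f ⊔ B := by
    rw [LinearMap.ker_comp, Submodule.ker_mkQ, Submodule.comap_map_eq, sup_comm]
  refine ⟨(Submodule.quotEquivOfEq _ _ hker.symm).trans (g.quotKerEquivOfSurjective hg), ?_⟩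
  intro x
  rfl

/-- If the bilinear map `b` is left-perfect (every linear functional on `L` is of the form `b x`)
and the submodule `B` admits a linear retraction, then restriction of `b x` to `B` is surjective
onto the dual of `B`. -/
theorem soloBlind_restrict_surjective (b : L →ₗ[R] L →ₗ[R] R)
    (hb : Function.Surjective b) (B : Submodule R L) (r : L →ₗ[R] B)
    (hr : ∀ y : B, r y = y) :
    Function.Surjective (b.compl₂ B.subtype) := by
  intro φ
  obtain ⟨x, hx⟩ := hb (φ.comp r)
  refine ⟨x, ?_⟩
  ext y
  simp [LinearMap.compl₂_apply, hx, hr y]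

/-- The glue-group isomorphism: with `b` left-perfect and `B` a retract, restriction induces
`L ⧸ (B^⊥ ⊔ B) ≃ₗ B^∨ ⧸ (range of the Gram map B → B^∨)`, where `B^⊥ = ker (restriction)`. -/
theorem soloBlind_glueGroup_equiv (b : L →ₗ[R] L →ₗ[R] R)
    (hb : Function.Surjective b) (B : Submodule R L) (r : L →ₗ[R] B)
    (hr : ∀ y : B, r y = y) :
    ∃ e : (L ⧸ (LinearMap.ker (b.compl₂ B.subtype) ⊔ B)) ≃ₗ[R]
        (Module.Dual R B ⧸ LinearMap.range ((b.compl₂ B.subtype).comp B.subtype)),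
      ∀ x : L, e (Submodule.Quotient.mk x) = Submodule.Quotient.mk (b.compl₂ B.subtype x) := by
  have hmap : B.map (b.compl₂ B.subtype) = LinearMap.range ((b.compl₂ B.subtype).comp B.subtype) := by
    rw [LinearMap.range_comp, Submodule.range_subtype]
  obtain ⟨e, he⟩ := soloBlind_quotKerSup_equiv (b.compl₂ B.subtype)
    (soloBlind_restrict_surjective b hb B r hr) B
  refine ⟨e.trans (Submodule.quotEquivOfEq _ _ hmap), ?_⟩
  intro x
  simp [he]

/-- The kernel of restriction is the (left) orthogonal of `B`: `x ∈ B^⊥ ↔ ∀ y ∈ B, b x y = 0`. -/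
theorem soloBlind_mem_ker_restrict (b : L →ₗ[R] L →ₗ[R] R) (B : Submodule R L) (x : L) :
    x ∈ LinearMap.ker (b.compl₂ B.subtype) ↔ ∀ y ∈ B, b x y = 0 := by
  constructor
  · intro hx y hy
    have := LinearMap.congr_fun (LinearMap.mem_ker.mp hx) ⟨y, hy⟩
    simpa [LinearMap.compl₂_apply] using this
  · intro h
    rw [LinearMap.mem_ker]
    ext ⟨y, hy⟩
    simpa [LinearMap.compl₂_apply] using h y hy

/-- Index form: `#(L ⧸ (B^⊥ ⊔ B)) = #(B^∨ ⧸ Gram(B))` (both sides as `Nat.card`, so `0` when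
infinite). In THEOREM Φ this is `[L : A ⊕ B] = #Φ_w(J^{Mw})` after tensoring with `ℤ_ℓ`. -/
theorem soloBlind_glueGroup_card (b : L →ₗ[R] L →ₗ[R] R)
    (hb : Function.Surjective b) (B : Submodule R L) (r : L →ₗ[R] B)
    (hr : ∀ y : B, r y = y) :
    Nat.card (L ⧸ (LinearMap.ker (b.compl₂ B.subtype) ⊔ B)) =
      Nat.card (Module.Dual R B ⧸ LinearMap.range ((b.compl₂ B.subtype).comp B.subtype)) := by
  obtain ⟨e, -⟩ := soloBlind_glueGroup_equiv b hb B r hr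
  exact Nat.card_congr e.toEquiv

end Summit.Langlands.Langlands.Theorems
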